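/-
Origin: expansion seat `planner-pub-hodgecm-pv06-g3-0`, handover #4 2026-08-18T06:29:32Z (`HOME/pub-hodgecm-pv06-g3/lean/Pv06g3/WeightProjection.lean`, md5 1f93046b, 247 lines);
landed by the gen-7 packager in gate run 25 as `HodgeCM/PerL34/WeightProjection.lean` (verbatim).
-/
/-
Origin: HOME/pub-hodgecm-pv06-g3/lean/Pv06g3/WeightProjection.lean — session planner-pub-hodgecm-pv06-g3-0 (unit
pub-hodgecm-pv06-g3, DAG-NODE PROVER #06 of 15, generation 3).  Intended final place: `HodgeCM/PerL34/WeightProjection.lean`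
(namespace `HodgeCM.PerL34.WeightProjection`).  Imports ONLY the landed `HodgeCM.Automorphic.IsotypicDecomposition` (run 23;
`RepDecomp.Ew`) and `HodgeCM.Automorphic.ThetaCarrierRep` (run 23; for the carrier corollary) + Mathlib.  Closed: nothing cited,
nothing posited.

# The weight projection `P_w = ∫_{T} w̄(t) R(t) dt` — PerL v5 ll. 387–392, KERNEL

PerL (ll. 387–392): "let `w` be a character of the compact torus `T(L₀ ⊗ ℝ)` … for `v ∈ L²([U(W)])` put
`v_w := ∫_{T(L₀⊗ℝ)} \bar w(t) R(t) v dt`; `v ↦ v_w` is the (orthogonal) projection onto the `w`-eigenspace `L²_w`, and it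
commutes with `R(U(W)(𝔸_f))`."  In the package this sentence is the FIELD

  `AnnihilationDatum.Pw_def : ∀ v, D.Pw v = ∫ t, conj (w t) • C.R (ιT t) v ∂μ`   (`HodgeCM/PerL34/Annihilation.lean` :261)

relating the carrier's `P_w` (`TorusData.Pw`; for the gen-2/3 carriers `TorusCarrier.Pw := EwC.starProjection`, the orthogonal
projection onto the closed joint `w`-eigenspace `RepDecomp.Ew C.R torus w`, `ThetaCarrierRep.toTorusCarrier_EwC`) to the Haar
average.  Here it is PROVED, abstractly: for ANY inner-product-preserving `R : G →* (H →L[ℂ] H)`, any compact group `Tc`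
with a left-invariant probability measure `μ`, any hom `ιT : Tc →* G` along which `R` is strongly continuous, and any
continuous unitary character `w : Tc →* ℂ` (`‖w t‖ = 1`):

* `wAvg … v := ∫ t, conj (w t) • R (ιT t) v ∂μ`;
* `wAvg_mem_Ew` — `wAvg v ∈ E_w` (left invariance of `μ`);  `wAvg_eq_self` — `wAvg v = v` for `v ∈ E_w` (`|w|² = 1`,
  `μ` a probability);  `sub_wAvg_mem_orthogonal` — `v − wAvg v ⊥ E_w` (unitarity of `R`);
* **`starProjection_Ew_eq_wAvg`** — `E_w.starProjection v = ∫ t, conj (w t) • R (ιT t) v ∂μ`, and the same for the closure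
  `E_w.topologicalClosure` (`starProjection_closure_Ew_eq_wAvg`; `E_w` is closed anyway) — i.e. `Pw_def` BY NAME for every
  carrier whose `P_w` is the orthogonal projection onto `RepDecomp.Ew R ιT w` (or onto a `RepDecomp.Ew R torus w'` with the
  same eigenspace, `starProjection_eq_wAvg_of_Ew_eq`);
* `wAvg_comm` — `R g (wAvg v) = wAvg (R g v)` whenever `g` commutes with `ιT(Tc)` ("commutes with `R(U(W)(𝔸_f))`", l. 392).
-/
import Summits.HodgeConjecture.HodgeCM.Automorphic.IsotypicDecomposition_2
import Summits.HodgeConjecture.HodgeCM.Automorphic.ThetaCarrierRep_2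
import Mathlib.MeasureTheory.Group.Integral
import Mathlib.MeasureTheory.Function.L2Space
import Mathlib.MeasureTheory.Function.LocallyIntegrable
import Mathlib.MeasureTheory.Integral.Bochner.ContinuousLinearMap

set_option autoImplicit false

noncomputable section

open MeasureTheory Filter Topology Set
open scoped InnerProductSpace ComplexConjugate

namespace HodgeCM
namespace PerL34
namespace WeightProjection

open HodgeCM.RepDecomp HodgeCM.PerL34.Spectral

/-! ### The unitary character -/
section Character

variable {Tc : Type*} [Group Tc] {w : Tc →* ℂ}

/-- (Ported verbatim from the HodgeCMPerL package; no docstring in the source.) -/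
theorem w_inv_mul (s : Tc) : w s⁻¹ * w s = 1 := by
  rw [← map_mul, inv_mul_cancel, map_one]

/-- (Ported verbatim from the HodgeCMPerL package; no docstring in the source.) -/
theorem conj_w_mul_w (hw1 : ∀ t, ‖w t‖ = 1) (t : Tc) : conj (w t) * w t = 1 := by
  rw [Complex.conj_mul', hw1, Complex.ofReal_one, one_pow]

/-- For a unitary character, `conj (w s⁻¹) = w s`. -/
theorem conj_w_inv (hw1 : ∀ t, ‖w t‖ = 1) (s : Tc) : conj (w s⁻¹) = w s := by
  have h1 : w s⁻¹ = (w s)⁻¹ := eq_inv_of_mul_eq_one_left (w_inv_mul s)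
  rw [h1, Complex.inv_eq_conj (hw1 s), Complex.conj_conj]

end Character

variable {G : Type*} [Group G]
variable {H : Type*} [NormedAddCommGroup H] [InnerProductSpace ℂ H] [CompleteSpace H]
variable (R : G →* (H →L[ℂ] H))
variable {Tc : Type*} [Group Tc] [MeasurableSpace Tc] (μ : Measure Tc) (ιT : Tc →* G) (w : Tc →* ℂ)

/-- **`v_w := ∫_T \bar w(t) R(t) v dt`** (PerL v5 l. 390). -/
def wAvg (v : H) : H := ∫ t, conj (w t) • R (ιT t) v ∂μ

omit [CompleteSpace H] in
/-- (Ported verbatim from the HodgeCMPerL package; no docstring in the source.) -/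
theorem wAvg_def (v : H) : wAvg R μ ιT w v = ∫ t, conj (w t) • R (ιT t) v ∂μ := rfl

variable [TopologicalSpace Tc] [CompactSpace Tc] [BorelSpace Tc]

/-! ### Integrability of the integrand -/
section Integrable

variable {R μ ιT w}
variable [IsFiniteMeasureOnCompacts μ]

omit [CompleteSpace H] [MeasurableSpace Tc] [CompactSpace Tc] [BorelSpace Tc] [IsFiniteMeasureOnCompacts μ] in
/-- (Ported verbatim from the HodgeCMPerL package; no docstring in the source.) -/
theorem continuous_integrand (hw : Continuous w) (hRc : ∀ v : H, Continuous fun t => R (ιT t) v) (v : H) :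
    Continuous fun t => conj (w t) • R (ιT t) v :=
  (Complex.continuous_conj.comp hw).smul (hRc v)

omit [CompleteSpace H] in
/-- (Ported verbatim from the HodgeCMPerL package; no docstring in the source.) -/
theorem integrable_integrand (hw : Continuous w) (hRc : ∀ v : H, Continuous fun t => R (ιT t) v) (v : H) :
    Integrable (fun t => conj (w t) • R (ιT t) v) μ :=
  (continuous_integrand hw hRc v).integrable_of_hasCompactSupport (HasCompactSupport.of_compactSpace _)

end Integrable

section Main

variable {R μ ιT w}
variable [IsFiniteMeasureOnCompacts μ]
variable (hw : Continuous w) (hw1 : ∀ t, ‖w t‖ = 1) (hRc : ∀ v : H, Continuous fun t => R (ιT t) v)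

include hw hRc in
/-- Pushing `R g` through the average. -/
theorem apply_wAvg (g : G) (v : H) :
    R g (wAvg R μ ιT w v) = ∫ t, conj (w t) • R (g * ιT t) v ∂μ := by
  rw [wAvg_def, ← (R g).integral_comp_comm (integrable_integrand hw hRc v)]
  refine integral_congr_ae (Eventually.of_forall fun t => ?_)
  dsimp only
  rw [ContinuousLinearMap.map_smul, map_mul]
  rfl

omit [TopologicalSpace Tc] [CompactSpace Tc] [BorelSpace Tc] [IsFiniteMeasureOnCompacts μ] in
include hw1 in
/-- **`v_w = v` on `E_w`** (`μ` a probability measure, `|w|² = 1`). -/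
theorem wAvg_eq_self [IsProbabilityMeasure μ] {v : H} (hv : v ∈ Ew R ιT w) : wAvg R μ ιT w v = v := by
  rw [mem_Ew] at hv
  rw [wAvg_def]
  have key : (fun t => conj (w t) • R (ιT t) v) = fun _ => v := by
    funext t
    rw [hv t, smul_smul, conj_w_mul_w hw1, one_smul]
  rw [key, integral_const, probReal_univ, one_smul]

include hw hw1 hRc in
/-- For `u ∈ E_w`: `⟪u, v_w⟫ = ⟪u, v⟫` (unitarity of `R`). -/
theorem inner_wAvg_of_mem_Ew [IsProbabilityMeasure μ] (hU : IsUnitaryRep R) {u : H} (hu : u ∈ Ew R ιT w) (v : H) :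
    ⟪u, wAvg R μ ιT w v⟫_ℂ = ⟪u, v⟫_ℂ := by
  rw [mem_Ew] at hu
  rw [wAvg_def, ← integral_inner (integrable_integrand hw hRc v)]
  have key : (fun t => ⟪u, conj (w t) • R (ιT t) v⟫_ℂ) = fun _ => ⟪u, v⟫_ℂ := by
    funext t
    have h1 : ⟪u, R (ιT t) v⟫_ℂ = ⟪R (ιT t)⁻¹ u, v⟫_ℂ := by
      rw [hU.inner_apply_left, inv_inv]
    rw [inner_smul_right, h1, ← map_inv, hu t⁻¹, inner_smul_left, conj_w_inv hw1, ← mul_assoc,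
      conj_w_mul_w hw1, one_mul]
  rw [key, integral_const, probReal_univ, one_smul]

include hw hw1 hRc in
/-- **`v − v_w ⊥ E_w`.** -/
theorem sub_wAvg_mem_orthogonal [IsProbabilityMeasure μ] (hU : IsUnitaryRep R) (v : H) :
    v - wAvg R μ ιT w v ∈ (Ew R ιT w)ᗮ := by
  rw [Submodule.mem_orthogonal]
  intro u hu
  rw [inner_sub_right, inner_wAvg_of_mem_Ew hw hw1 hRc hU hu, sub_self]

include hw hRc in
/-- **`P_w` commutes with `R(g)` for every `g` commuting with the torus** (l. 392: with `R(U(W)(𝔸_f))`). -/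
theorem wAvg_comm {g : G} (hg : ∀ t, g * ιT t = ιT t * g) (v : H) :
    R g (wAvg R μ ιT w v) = wAvg R μ ιT w (R g v) := by
  rw [apply_wAvg hw hRc, wAvg_def]
  refine integral_congr_ae (Eventually.of_forall fun t => ?_)
  dsimp only
  rw [hg t, map_mul]
  rfl

variable [IsTopologicalGroup Tc]

include hw hw1 hRc in
/-- **`v_w ∈ E_w`**: the average is a joint `w`-eigenvector (left invariance of `μ`). -/
theorem wAvg_mem_Ew [μ.IsMulLeftInvariant] (v : H) : wAvg R μ ιT w v ∈ Ew R ιT w := by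
  rw [mem_Ew]
  intro s
  rw [apply_wAvg hw hRc]
  have key : (∫ t, conj (w t) • R (ιT s * ιT t) v ∂μ)
      = ∫ t, (fun u => conj (w (s⁻¹ * u)) • R (ιT u) v) (s * t) ∂μ := by
    refine integral_congr_ae (Eventually.of_forall fun t => ?_)
    dsimp only
    simp only [inv_mul_cancel_left, map_mul]
  rw [key, integral_mul_left_eq_self (fun u => conj (w (s⁻¹ * u)) • R (ιT u) v) s]
  have key2 : (fun u => conj (w (s⁻¹ * u)) • R (ιT u) v) = fun u => w s • (conj (w u) • R (ιT u) v) := by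
    funext u
    rw [map_mul, map_mul, conj_w_inv hw1, smul_smul]
  rw [key2, integral_smul, wAvg_def]

include hw hw1 hRc in
/-- **THE WEIGHT PROJECTION FORMULA** (PerL v5 ll. 390–391; the field `AnnihilationDatum.Pw_def`): the orthogonal
projection onto the joint `w`-eigenspace IS the Haar average `v ↦ ∫_T \bar w(t) R(t) v dt`. -/
theorem starProjection_Ew_eq_wAvg [IsProbabilityMeasure μ] [μ.IsMulLeftInvariant] (hU : IsUnitaryRep R)
    [(Ew R ιT w).HasOrthogonalProjection] (v : H) :
    (Ew R ιT w).starProjection v = ∫ t, conj (w t) • R (ιT t) v ∂μ :=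
  Submodule.eq_starProjection_of_mem_orthogonal (wAvg_mem_Ew hw hw1 hRc v) (sub_wAvg_mem_orthogonal hw hw1 hRc hU v)

/-- `(closure K)ᗮ = Kᗮ`. -/
theorem orthogonal_topologicalClosure (K : Submodule ℂ H) : K.topologicalClosureᗮ = Kᗮ := by
  rw [← Submodule.orthogonal_orthogonal_eq_closure, Submodule.triorthogonal_eq_orthogonal]

include hw hw1 hRc in
/-- The same for ANY submodule equal to `E_w` — e.g. a carrier's `RepDecomp.Ew C.R torus w'` indexed differently —
and for its CLOSURE (the gen-2/3 carriers' `TorusCarrier.Pw := EwC.starProjection`). -/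
theorem starProjection_eq_wAvg_of_Ew_eq [IsProbabilityMeasure μ] [μ.IsMulLeftInvariant] (hU : IsUnitaryRep R)
    {K : Submodule ℂ H} (hK : K = Ew R ιT w) [K.topologicalClosure.HasOrthogonalProjection] (v : H) :
    K.topologicalClosure.starProjection v = ∫ t, conj (w t) • R (ιT t) v ∂μ := by
  refine Submodule.eq_starProjection_of_mem_orthogonal (K.le_topologicalClosure ?_) ?_
  · rw [hK]; exact wAvg_mem_Ew hw hw1 hRc v
  · rw [orthogonal_topologicalClosure, hK]; exact sub_wAvg_mem_orthogonal hw hw1 hRc hU v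

include hw hw1 hRc in
/-- (Ported verbatim from the HodgeCMPerL package; no docstring in the source.) -/
theorem starProjection_closure_Ew_eq_wAvg [IsProbabilityMeasure μ] [μ.IsMulLeftInvariant] (hU : IsUnitaryRep R)
    [(Ew R ιT w).topologicalClosure.HasOrthogonalProjection] (v : H) :
    (Ew R ιT w).topologicalClosure.starProjection v = ∫ t, conj (w t) • R (ιT t) v ∂μ :=
  starProjection_eq_wAvg_of_Ew_eq hw hw1 hRc hU rfl v

end Main

/-! ### Reindexing the torus family, and the gen-3 carrier's `P_w` -/
section Carrier

omit [CompleteSpace H] in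
/-- The joint eigenspace only depends on the RANGE of the indexed family `(ι, w)`. -/
theorem Ew_comp_of_surjective {α β : Type*} (ι' : α → β) (hι' : Function.Surjective ι') (ι : β → G) (w' : β → ℂ) :
    Ew R (ι ∘ ι') (w' ∘ ι') = Ew R ι w' := by
  ext v
  simp only [mem_Ew, Function.comp_apply]
  constructor
  · intro h t
    obtain ⟨a, rfl⟩ := hι' t
    exact h a
  · intro h a
    exact h (ι' a)

variable {HH HG CG GG SK SigIdxG : Type}
variable [NormedAddCommGroup HH] [InnerProductSpace ℂ HH] [CompleteSpace HH]
variable [NormedAddCommGroup HG] [InnerProductSpace ℂ HG] [CompleteSpace HG]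
variable [NormedAddCommGroup CG] [NormedSpace ℂ CG]
variable [Group GG] [TopologicalSpace GG] [TopologicalSpace SK]
variable {C : RepCoreCarrier HH HG CG GG SK SigIdxG} (D : RepTorusCarrier C)
variable [IsTopologicalGroup Tc] [IsProbabilityMeasure μ] [μ.IsMulLeftInvariant] {ιG : Tc →* GG} {w}

/-- **`Pw_def` for the gen-3 carriers**: `D.toTorusCarrier.Pw v = ∫ t, conj (w t) • C.R (ιG t) v ∂μ` as soon as the
carrier's joint eigenspace `D.Ew = RepDecomp.Ew C.R D.torus D.w` is the one of `(ιG, w)` (`rfl` when `D.torus = ⇑ιG`,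
`D.w = ⇑w`; `Ew_comp_of_surjective` when `D`'s family is a reindexing of it), `R` is unitary (`Analytic.R_unitary`) and
strongly continuous along the torus. -/
theorem RepTorusCarrier_Pw_apply (hU : IsUnitaryRep C.R) (hw : Continuous w) (hw1 : ∀ t, ‖w t‖ = 1)
    (hRc : ∀ v : HH, Continuous fun t => C.R (ιG t) v) (hE : D.Ew = Ew C.R ιG w) (v : HH) :
    D.toTorusCarrier.Pw v = ∫ t, conj (w t) • C.R (ιG t) v ∂μ :=
  starProjection_eq_wAvg_of_Ew_eq hw hw1 hRc hU hE v

end Carrier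

end WeightProjection
end PerL34
end HodgeCM

end
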